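import Summits.Schanuel.Schanuel.Theorems.RootDecomp1KOddEmpty05
import Literature.NumberTheory.DiophantineGeometry.SiegelIntegralPointsReduction
import Literature.NumberTheory.DiophantineGeometry.SiegelCubicReduction
import Literature.NumberTheory.DiophantineGeometry.UnitEquationFinite

/-!
# RootDecomp1KSiegelGenusOne — lens 1, generation 61, NODE 22 «SIEGEL ON THE K-LINE» (the genus-one class SW e := (Y⁴−17)x² + (Y²+17Y−17)x + e: Weierstrass model over ℚ(θ), θ⁴ = 17, X_E-stable integral lattice, Siegel's theorem for S-integral points — PROVED in the tree — ⇒ finitely many level ordinates/abscissae ⇒ LevelFinite / ThinFibreAt for every e with dQ e ≠ 0; the pinned K-R52-territory family S' j; RULE K-R40 (ii-b) / K-R52 (iii) payable clause; CLAIM L2826, PRICE L2834, REPAIR L2845, K-R53) — part 1 (RootDecomp1KSiegelGenusOne01): §A the genus-one model: Taylor data, the Weierstrass curve cW, the point (XE, YE), its equation, Δ ≠ 0, recovery of r (section Algebra)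

(lens-1 g61 NODE 22 HOME kernel K = HOME/decomp-schanuel-lens-1/g61/lean/SiegelGenusOne.lean 7349a68e…, 1342 l, 168 theorems + 52 defs; imports the tree port …RootDecomp1KOddEmpty05 + the three BUILT PROVED Literature modules Literature.NumberTheory.DiophantineGeometry.{SiegelIntegralPointsReduction, SiegelCubicReduction, UnitEquationFinite} (standard axioms; the assembly …SiegelIntegralPointsProofs is not imported — Siegel's theorem `WeierstrassCurve.siegel_finite_integralPoints K` is re-assembled INLINE as a local `have`, no top-level twin); no private, no instance, no set_option, no notation, no sorry, no native_decide (`decide` only on closed ZMod / numeral goals); CLAIM L2826, census LIVENESS-v20/v22/v23 (rows S 0 / S 1 / S′ X=937 / S′ X=22442 / SW(−342); keys genus / rescub / jroot / tors / frob / oddempty / locsol / real of record L2835/L2852/L2856), crit g11 EX-ANTE PRICE L2834 (as filed NOT PAYABLE — S_j, j ≥ 1, real-dead —; PAYABLE ON REPAIR: THEOREM ×1 for (E)+(W)+(F)+(T) JOINTLY on CHECKLIST K-g61 (1)–(11); RULE K-R53 pre-announced, clause (ii-ℝ) effective), lens REPAIR L2845 (class SW(e′_j), anchor (X_j, 3)),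 crit REPLY/PRICE-CONFIRMATION L2849 + ERRATUM L2852 (pin X_j = 21505j + 937; PRICE STANDS), writer g32 NOTES 2/8/10 (pre-kernel arithmetic), NODE L2861 / REQUEST L2862, critic VERDICT L2864 (crit g11): CLEARED — THEOREM ×1 for (E)+(W)+(F)+(T) JOINTLY, ONE credit (engine `levelFinite_SW (e) (hd : dQ e ≠ 0)` by the tree's PROVED Siegel theorem assembled inline; class `S' j = SW (−64·X_j² − 43·X_j)`, `X_j = 21505j + 937`, real-live at every level, K-R51-certified uniformly via the pins 5 / 11 / 23); CHECKLIST K-g61 (1)–(11) met item by item (K rc 0 · 0 errors · 0 sorries; Probe rc 0 with 263 `#print axioms` guards all standard; Ctrl0 rc 0; Ctrl rc 1 with exactly the 46 planted errors; tokens: sorry / native_decide / private / instance / set_option / structure / fact-def all 0, `SiegelClause` only in conclusion position); LABEL OF RECORD: literature KNOWN TOOL (Siegel 1929 genus one / AEC IX.3.2.2 base change) · problem-relative NEW LEVER on the K-line (first global finiteness theorem; first PROVED binder-class input, `SiegelClause` discharged on an infinite certified-territory class); TALLY lens-1 ×19 + THEOREM ×21; RULE K-R53 FIXED verbatim as pre-announced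 L2834 ((i) toolkit ∪= Siegel transfer in general, ×0-as-record; (ii) open territory at m₀ = 2 := K-R52 territory ∧ live at every place incl. ℝ ∧ genus ≥ 2 not transfer-reachable, standing witness W4; (iii) payable: uniform ThinFibre 2 / a binder proved / W4 itself / a genus-≥2 territory class by a new lever / the genus-one grade uniformly — ask first; (iv) unconditional part ∪= {P : a Siegel transfer datum is typed} — today SW e, dQ e ≠ 0); lens DONE L2865; PORT GO L2866 exactly as census STAGING NOTE 12 L2863 (five parts, the Family split accepted). Port by census-1 gen 23 as `RootDecomp1KSiegelGenusOne01–05` (`--supports stmt-Schanuel-33364`; no census credit): 01 = §A the genus-one model over a field with t⁴ = 17 (Taylor data, `cW`, the point `(XE, YE)`, `equation_XE_YE`, `c₄`/`c₆`/`Δ ≠ 0`, recovery of r; section Algebra); 02 = §B valuation bounds, the max trick `val_le_one_of_eigen`, the `X_E`-stable lattice and its matrix (sections Valuation, Lattice) and §C the number field ℚ(θ), Siegel's theorem assembled inline from the three proved Literature theorems, `finite_ordinates_dyadic` / `finite_abscissae_dyadic` / finiteness of level ordinates and abscissae (section Finiteness); 03 = §D part 1: the class `SW e`, `levelFinite_SW`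 / `thinFibreAt_SW` / `bddLevelEmpty_SW` / `siegelClause_SW` for every e with `dQ e ≠ 0`, the real place (dead side / live side), up to `not_rootlessTop_SW` (section Family, first half); 04 = §D part 2: the refusals `not_decidedAt_two_SW` / `not_localAt_SW` / `not_gaussAt_SW` / …, the pinned family `sX' j = 21505j + 937`, `sE'`, `S'`, `dQ_sE'_ne_zero` uniformly, `levelFinite_S'` / `thinFibreAt_S'` / `S'_real_live`, the decided member SW(−342), the filed (withdrawn) family S j (section Family, second half — re-opened with K's own open-lines); 05 = §E TERRITORY: Δ_x(SW e) 17-Eisenstein ⇒ irreducible quartic, the resolvent certificate mod 11, `S'_territory` by tree names (section Territory). PORT EDITS: NONE — no docstring added (K documents every declaration), no privatisation, no re-pointing, no import change, no set_option; the only structural edit is the split of `section Family` at the declaration boundary before `not_decidedAt_two_SW` (part 03 closes it with an inserted `end Family`, part 04 re-opens it with K's own 20 `open` lines ll. 661–680 verbatim; no `variable` lives in that section); provenance doc blocks + continuation headers (`noncomputable section`, `namespace`, `open Polynomial`, `open scoped Classical`) = K's own; statements and proofs VERBATIM. Rung 0 — nothing here proves Schanuel, 33364, 33363, 31077 or ThinFibre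 2; everything HYPOTHESIS-FREE (the Literature inputs are proved theorems).)
-/

/-
Copyright (c) 2026. All rights reserved.
Released under Apache 2.0 license as described in the file LICENSE.
-/

/-!
# RootDecomp1KSiegelGenusOne — lens 1, generation 61, NODE 22 «SIEGEL ON THE K-LINE»

THE LEVER (SIEGEL'S THEOREM FOR GENUS ONE — PROVED IN THE TREE).  The class is
`SW e := (Y⁴ − 17)·x² + (Y² + 17Y − 17)·x + e` (`x`-degree 2, `Y`-degree `4 = 2·xdeg`, W4's top `vQ = Y⁴ − 17`); its
`x`-discriminant `Δ_x = sD e = (1 − 4e)Y⁴ + 34Y³ + 255Y² − 578Y + (289 + 68e)` is a QUARTIC, so for `dQ e ≠ 0` the curve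
`SW e = 0` is a double cover of the `Y`-line branched at 4 points: GENUS ONE.  Over the number field `K = ℚ(θ)`, `θ⁴ = 17`
(`AdjoinRoot (vQ.map _)`, a `NumberField` from the tree's `irreducible_vQ_rat`):

* §A (THE MODEL, any field with `t⁴ = 17`).  From `P(x, r) = 0`: `u₀² = D(r)` with `u₀ = 2x(r⁴ − 17) + (r² + 17r − 17)`
  (`u0_sq`); the Taylor data `d1 … d4`, `w1 t = −(t² + 17t − 17)` (`D(t) = w1²`), `mm`, `L1`, `L0`, `Qt`, and
  `64·w1⁶·D(r) = Qt(s)² + s³(L1 + L0·s)`, `s = r − t` (`Qt_sq`); the point `(XE, YE) = (ζ/s², 4w1²ζ/s³)`,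
  `ζ = 8w1³u₀ + Qt(s)`, lies ON THE WEIERSTRASS CURVE `cW t e = ⟨2d1, −2mm, 16w1⁴d3 − 2d1·mm, −64w1⁶d4 + mm², 0⟩`
  (`equation_XE_YE`); its invariants are `c₄ = 2⁸w1⁸·Ĩ`, `c₆ = −2¹²w1¹²·J̃` with `Ĩ = 12·iK e`, `J̃ = −216·jK e`
  (`cW_c₄`, `cW_c₆`, `iTilde_eq`, `jTilde_eq`), so `Δ(cW t e) ≠ 0 ⟸ 4·iK e³ − jK e² ≠ 0` (`delta_ne_zero`, via
  Mathlib's `c_relation : 1728Δ = c₄³ − c₆²`); and `r` is RECOVERED from `(XE, YE)` (`recov_XE_YE`: `r = t + 4w1²·XE/YE`,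
  or `t − L1/L0` on `YE = 0`), so `(x, r) ↦ (XE, YE)` is finite-to-one.
* §B (INTEGRALITY by the MAX TRICK, any valuation `v`).  `ζ·b = s²·Mx·b` for the basis `b = (1, xr, xr², x²r³)` with a
  4×4 matrix `Mx` whose entries are polynomials in `t, e, x` with INTEGER coefficients — four identities modulo `P`
  (`latt0 … latt3`, certified by exact division in `ℚ(θ)[e, x, r]`), hence `XE` is an EIGENVALUE of `Mx` on `b`
  (`eigen_XE`); `val_le_one_of_eigen` (if every `v(M i j) ≤ 1` and `M·b = λ·b` with `b ≠ 0` then `v λ ≤ 1` — take the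
  coordinate of maximal valuation); so `v t ≤ 1 → v e ≤ 1 → v x ≤ 1 → v (XE t e x r) ≤ 1` (`val_XE_le_one`).
* §C (FINITENESS).  Siegel's theorem `WeierstrassCurve.siegel_finite_integralPoints K` is assembled INLINE (a local
  `have` inside `finite_ordinates_dyadic`, no top-level twin) from three PROVED theorems of
  `Literature.NumberTheory.DiophantineGeometry` (standard axioms, `Probe.lean` R4): `finite_unitEquation` (the `S`-unit
  equation `u + v = 1`), `finite_integer_sq_eq_cubic_of_unitEquation` (the cubic / 2-descent reduction) and
  `siegel_finite_integralPoints_of_cubic`.  With `T = {v | v(2) ≠ 1}` (finite, `setOf_valuation_ne_one_finite`; the model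
  `cW` is scaled integral, so no prime above `17` and no `w1` is needed in `T`) and a DYADIC abscissa `ξ ∈ ℤ[1/2]`
  (tree `IsDyadic`; `v(ξ) ≤ 1` off `T`), Siegel's finiteness of the `T`-integral points of `cW θ e`
  (`finite_setOf_equation_of_siegel`) and `recov` give **`finite_ordinates_dyadic (e) (hd : dQ e ≠ 0) :
  {ρ : ℚ | ∃ ξ, IsDyadic ξ ∧ pS e ξ ρ = 0}.Finite`**, `finite_abscissae_dyadic`, **`finite_dyadicPoints`** and, through
  `den(s_N) ∣ 2^{N!}` ALONE (tree `isDyadic_sQ`, `sQ_cast`), the level corollaries `finite_ordinates`, `finite_abscissae`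
  (`dQ e = 4·iQ e³ − jQ e²`, `iQ e = 127449 − 13056e − 3264e²`, `jQ e = −90998586 + 13982976e − 4993920e²`).
* §D (THE CLASS IN TREE CURRENCY).  `SW e = xPolyP 2 (sC e)` (`sC e 2 = vQ`, `sC e 1 = sG = Y² + 17Y − 17`,
  `sC e 0 = C e`), `bev_SW`, `bev_SW_eq_pS`, `pS_eq_zero_of_bev`; THE REAL PLACE: **`bev_SW_pos` (`247 ≤ e`, `0 < x ≤ 2`
  ⇒ `SW e (x, y) > 0` for every real `y` — the DEAD side)** and **`exists_real_root_SW` (`e ≤ 0`, `1/2 ≤ x` ⇒ a real zero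
  — the LIVE side, IVT)**, `hasDerivAt_bev_SW` (the `x`-partial, typed); at most two abscissae per ordinate and
  `finite_levels_of_finite` (tree, `sQ` injective) give `finite_pointed_levels_SW` (ALL BUT FINITELY MANY LEVELS ARE
  EMPTY), **`levelFinite_SW (e) (hd : dQ e ≠ 0) : LevelFinite (SW e)`**, `bddLevelEmpty_SW`, **`thinFibreAt_SW (e) (hd) :
  ∀ m₀, ThinFibreAt m₀ (SW e)`** (tree `thinFibreAt_of_levelFinite`; every `m₀`, including `0`, `1`, `2`),
  **`finite_dyadicPoints_SW : {p : ℚ × ℚ | bev (SW e) p.1 p.2 = 0 ∧ IsDyadic p.1}.Finite`** (the form not tied to the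
  levels); the REFUSALS of the record's classes (`not_decidedAt_two_SW`, `not_localAt_SW`, `not_gaussAt_SW`,
  `not_xLinTM_SW`, `not_xLinearLt_SW`, `SW_ne_xLinP`, `SW_ne_twoTermP`, `SW_ne_normShapeCurve`, `SW_ne_CB`, `SW_ne_VW`,
  `not_oddEmptyAt_SW`) and node 11's CONDITIONAL class `sepTopAt_two_SW` (binder `PadicSubspace` BYPASSED, not proved).
  THE REPAIRED ℕ-FAMILY (bus REPAIR L2845 after crit PRICE L2834, progression PINNED at `23` per crit L2849/L2852)
  **`S' j := SW (sE' j)`, `sE' j = −64·X_j² − 43·X_j`, `X_j = sX' j = 21505j + 937`** (`21505 = 5·11·17·23`;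
  `e′₀ = −56 230 307`, `e′₁ = −32 234 140 302`) carries the SMOOTH ANCHOR POINT `(X_j, 3)` ON THE CURVE
  (`bev_S'_anchor`; `hasDerivAt_S'_anchor : ∂ₓ = 128X_j + 43 ≠ 0`; integral abscissa, so node 21's engines are REFUSED at
  EVERY prime: `not_oddEmptyAt_S'`, `not_tangentEmptyAt_S'`), is **REAL-LIVE AT EVERY LEVEL** (`S'_real_live : ∀ j N,
  ∃ r : ℝ, bev (S' j) (partialSum 2 N) r = 0`, from `sE'_nonpos` and the tree's `half_le_partialSum_cb`), and
  **`dQ_sE'_ne_zero (j) : dQ (sE' j) ≠ 0` UNIFORMLY** (`e′_j ≡ 3 (mod 5)` and `dQ ≡ 1 (mod 5)` on that class, `decide`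
  on `ZMod 5`; the residues `e′_j ≡ 3, 10, 15, 1 (mod 5, 11, 17, 23)` are typed: `dvd_sE'_sub_three/ten/fifteen/one` —
  the Frobenius data of `u² = Δ_x` at the three good pinned primes `5, 11, 23` are therefore CONSTANT in `j`, which is
  what makes the census's K-R51 keys `tors 1 ∧ jroot(2..13) none ∧ j2rat none` uniform, crit L2849); hence **`levelFinite_S'`, `bddLevelEmpty_S'`, `thinFibreAt_S' : ∀ j m₀, ThinFibreAt m₀
  (S' j)`**, `finite_pointed_levels_S'`, `finite_ordinates_S'`, `finite_dyadicPoints_S'`; `S'` injective (an INFINITE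
  class).  THE FILED FAMILY of CLAIM L2826, `S j := SW (16x_j² + 33x_j)`, `x_j = 935j − 2` (`e₀ = −2`, `e₁ = 13 958 613`),
  is kept ONLY as the typed degeneracy of record: **`S_level_pos : ∀ j ≥ 1, ∀ N (y : ℝ), 0 < bev (S j) (partialSum 2 N) y`**
  (REAL-DEAD: every level set EMPTY, `levelSet_S_eq_empty`, `levelFinite_S_of_dead` — by the toolkit, no Siegel), while
  `S 0 = SW (−2)` is real-live (`S_zero_real_live`, `levelFinite_S_zero`).
* §E (TERRITORY).  `xDisc (SW e) = sD e` (node 20's `xDisc`); for `e ≡ 15 (mod 17)` the quartic `sD e` is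
  17-EISENSTEIN (`isEisensteinAt_sD`) and PRIMITIVE (`IsCoprime 17 (1 − 4e)`), so ℚ-IRREDUCIBLE of degree `4 ≡ 0 (mod 4)`
  (`irreducible_sD_rat`, `irreducible_xDisc_S'` — the K-R51 `k = 2` GENUS-ONE certificate typed uniformly in `j`); the
  CUBIC RESOLVENT `sRes e` of `sD e` is ROOTLESS mod 11 uniformly in `j` (`sRes_no_root_mod_eleven`; `e′_j ≡ 10 (mod 11)`,
  `decide` on `ZMod 11`) — the census's `j2rat NONE` certificate (no rational 2-torsion abscissa of the Jacobian model);
  **`S'_territory (j)`**: the K-R49/K-R51/K-R52 conjunction by TREE NAMES (`x`-degree 2, `Y`-degree 4, top `Y⁴ − 17`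
  ℚ-irreducible of full degree with a `ℚ₂`-root and no ℚ-root, separable, `eTop = 0`, rate 1 (Bezout `bezout_s`,
  resultant `98821 = 17·5813`), `¬ DecidedAt 2`, `¬ LocalAt 2`, `∀ m₀ ¬ GaussAt m₀`, `¬ XLinTM`, `¬ XLinearLt`, not
  x-linear / two-term / norm shape / `CB` / `VW`, `3 ≤ thinThreshold`, `SepTopAt 2`, `Δ_x = sD (sE' j)` irreducible of
  degree `4 ≡ 0 (mod 4)`, resolvent rootless mod 11, the anchor point, `∀ ℓ ¬ OddEmptyAt ℓ`, `∀ ℓ ¬ TangentEmptyAt ℓ`) ∧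
  **finitely many pointed levels, finitely many level ordinates, `LevelFinite (S' j)`, `BddLevelEmpty (S' j)`,
  `∀ m₀, ThinFibreAt m₀ (S' j)`** ∧ the SMOOTH-POINT and **REAL-LIVENESS (`∀ N`)** conjuncts ∧ finitely many dyadic
  points; named members `S' 0 = SW (−56230307)` (`X₀ = 937`), `S' 1 = SW (−32234140302)` (`X₁ = 22442`) (`sE'_zero`,
  `sE'_one`, `levelFinite_S'0_S'1`, `S'0_territory`), and the decided member `SW (−342)` (`X = 2`, anchor `(2, 3)`, off
  the pinned progression; census row «S′ X=2»: `levelFinite_SW_neg_342`, `SW_neg_342_real_live`).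

HONESTY.  RUNG 0: nothing here proves Schanuel, `FiniteOrderLiouvilleSchanuel` (33364), 33363, 31077, 31987 or the
uniform `ThinFibre 2`; `PadicSubspace` / `HeightComparison` are untouched (node 11's class `SepTopAt 2` holds for every
`SW e` and is BYPASSED here, not proved).  The lever is a KNOWN TOOL (Siegel 1929, genus one; here through the tree's own
proof: unit equation → cubic reduction → integral points), INEFFECTIVE as used: K proves `LevelFinite (S' j)` — finitely
many levels carry a point of bounded (indeed of any) height — WITHOUT a bound for the exceptional levels and without listing
them; the theorem proved is FINITENESS OF THE RATIONAL POINTS WITH `ℤ[1/2]`-ABSCISSA on each member (`finite_dyadicPoints_SW`),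
and the level structure of the K-line enters only through `den(s_N) ∣ 2^{N!}`.  `LevelFinite` here is genuine
finiteness-WITH-points, not emptiness: the anchor `(X_j, 3)` is a smooth rational point, every local class is live, and
EVERY LEVEL IS REAL-LIVE (`S'_real_live`) — exactly the conjunct the FILED class `S j` (CLAIM L2826) FAILED for `j ≥ 1`
(crit PRICE L2834 (C): `S_j(x, Y) ≥ e_j − 246.5 > 0` on `0 < x ≤ 2`; typed here as `S_level_pos`, the filed class
WITHDRAWN as territory).  The class is CONSTRUCTED for the lever (a designed infinite class of open-territory pairs, not a
route binder).  The standing witness W4 = `(Y⁴ − 17)x² + (Y³ + 1)x + (Y + 2)` is NOT reached: its `Δ_x` is a SEXTIC (genus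
TWO), outside Siegel-genus-one; K mentions W4 only to TYPE that (`xDisc_W4P`, `natDegree_xDisc_W4P = 6`), the refusals
are in `Ctrl.lean`.  PER-MEMBER COST: the engine is
typed at the generality «the class `SW e`, `e : ℤ`, `dQ e ≠ 0`» — its identity fields (Taylor data, Weierstrass identity,
the 4×4 lattice, recovery, `c₄/c₆ ↦ I, J`) are polynomial identities for the FIXED pair `(c₂, c₁) = (Y⁴ − 17, Y² + 17Y − 17)`
and generic `e`; another `(c₂, c₁)` needs them re-derived (mechanically: `g61/py/ident.py`, `lattice.py`).  The three
`Literature` imports are PROVED THEOREMS with the standard axiom triple (no fact `def`, no hypothesis binder, no `sorry`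
anywhere in their closure — `Probe.lean` R4 prints it); K consumes NO unproved statement.

Namespace `Summit.Schanuel.Schanuel.Theorems.RootDecomp1KSiegelGenusOne`; imports the tree's port `…RootDecomp1KOddEmpty05`
and the three BUILT Literature modules `SiegelIntegralPointsReduction`, `SiegelCubicReduction`, `UnitEquationFinite`; no
`private`, no `instance`, no `set_option`, no notation, no `sorry`, no `native_decide` (`decide` only on closed goals over
`ZMod 5` / `ZMod 11` / `ZMod 17` / `ZMod 23` and closed integer numerals — never on a `ℚ`/`ℝ` statement or an open `ℤ` one);
`open scoped Classical` serves the case split in `recov` only; axioms standard (`Probe.lean` R4 prints every closure).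
-/

noncomputable section

namespace Summit.Schanuel.Schanuel.Theorems.RootDecomp1KSiegelGenusOne

open Polynomial
open scoped Classical

/-! ### §A  THE GENUS-ONE MODEL OVER A FIELD WITH `t⁴ = 17`: Taylor data of `D = c₁² − 4e·Q` at `t`, the Weierstrass
model `cW`, the point `(XE, YE)` attached to a curve point `(x, r)`, its equation, `Δ ≠ 0`, and the recovery of `r`. -/

section Algebra

variable {K : Type*} [Field K]

/-- `w₁ := −c₁(t) = −(t² + 17t − 17)` — the square root of `D(t)` (since `Q(t) = 0`). -/
def w1 (t : K) : K := -(t ^ 2 + 17 * t - 17)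
/-- `d₁ := D'(t)`. -/
def d1 (t e : K) : K := 4 * (1 - 4 * e) * t ^ 3 + 102 * t ^ 2 + 510 * t - 578
/-- `d₂ := D''(t)/2`. -/
def d2 (t e : K) : K := 6 * (1 - 4 * e) * t ^ 2 + 102 * t + 255
/-- `d₃ := D'''(t)/6`. -/
def d3 (t e : K) : K := 4 * (1 - 4 * e) * t + 34
/-- `d₄ := 1 − 4e`, the leading coefficient of `D`. -/
def d4 (e : K) : K := 1 - 4 * e
/-- `m := 4w₁²d₂ − d₁²`. -/
def mm (t e : K) : K := 4 * w1 t ^ 2 * d2 t e - d1 t e ^ 2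
/-- `L₁ := 64w₁⁶d₃ − 8w₁²d₁m`. -/
def L1 (t e : K) : K := 64 * w1 t ^ 6 * d3 t e - 8 * w1 t ^ 2 * d1 t e * mm t e
/-- `L₀ := 64w₁⁶d₄ − m²`. -/
def L0 (t e : K) : K := 64 * w1 t ^ 6 * d4 e - mm t e ^ 2
/-- `Q̃(s) := 8w₁⁴ + 4w₁²d₁s + ms²`. -/
def Qt (t e s : K) : K := 8 * w1 t ^ 4 + 4 * w1 t ^ 2 * d1 t e * s + mm t e * s ^ 2
/-- `u₀ := ∂P/∂x·(…)`-normalisation: `u₀ = 2x·Q(r) + c₁(r)`, so that `u₀² − D(r) = 4Q(r)·P(x, r)`. -/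
def u0 (x r : K) : K := 2 * x * (r ^ 4 - 17) + (r ^ 2 + 17 * r - 17)
/-- `ζ := 8w₁³u₀ + Q̃(r − t)`. -/
def zeta (t e x r : K) : K := 8 * w1 t ^ 3 * u0 x r + Qt t e (r - t)
/-- the affine curve `P_e(x, r) = Q(r)x² + c₁(r)x + e` with `Q = Y⁴ − 17`, `c₁ = Y² + 17Y − 17`. -/
def pS (e x r : K) : K := (r ^ 4 - 17) * x ^ 2 + (r ^ 2 + 17 * r - 17) * x + e
/-- the WEIERSTRASS MODEL `W' = ⟨2d₁, −2m, 16w₁⁴d₃ − 2d₁m, −64w₁⁶d₄ + m², 0⟩` over `K`. -/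
def cW (t e : K) : WeierstrassCurve K :=
  ⟨2 * d1 t e, -2 * mm t e, 16 * w1 t ^ 4 * d3 t e - 2 * d1 t e * mm t e, -64 * w1 t ^ 6 * d4 e + mm t e ^ 2, 0⟩
/-- `X_E := ζ / (r − t)²`. -/
def XE (t e x r : K) : K := zeta t e x r / (r - t) ^ 2
/-- `Y_E := 4w₁²ζ / (r − t)³`. -/
def YE (t e x r : K) : K := 4 * w1 t ^ 2 * zeta t e x r / (r - t) ^ 3
/-- the quartic invariant `I(D_e) = 127449 − 13056e − 3264e²`. -/
def iK (e : K) : K := 127449 - 13056 * e - 3264 * e ^ 2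
/-- the quartic invariant `J(D_e) = −90998586 + 13982976e − 4993920e²`. -/
def jK (e : K) : K := -90998586 + 13982976 * e - 4993920 * e ^ 2

/-- `(t e : K) : (cW t e).a₁ = 2 * d1 t e` (by `rfl`). -/
@[simp] theorem cW_a₁ (t e : K) : (cW t e).a₁ = 2 * d1 t e := rfl
/-- `(t e : K) : (cW t e).a₂ = -2 * mm t e` (by `rfl`). -/
@[simp] theorem cW_a₂ (t e : K) : (cW t e).a₂ = -2 * mm t e := rfl
/-- `(t e : K) : (cW t e).a₃ = 16 * w1 t ^ 4 * d3 t e - 2 * d1 t e * mm t e` (by `rfl`). -/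
@[simp] theorem cW_a₃ (t e : K) : (cW t e).a₃ = 16 * w1 t ^ 4 * d3 t e - 2 * d1 t e * mm t e := rfl
/-- `(t e : K) : (cW t e).a₄ = -64 * w1 t ^ 6 * d4 e + mm t e ^ 2` (by `rfl`). -/
@[simp] theorem cW_a₄ (t e : K) : (cW t e).a₄ = -64 * w1 t ^ 6 * d4 e + mm t e ^ 2 := rfl
/-- `(t e : K) : (cW t e).a₆ = 0` (by `rfl`). -/
@[simp] theorem cW_a₆ (t e : K) : (cW t e).a₆ = 0 := rfl

/-- TAYLOR: `D(r) = (w₁² − 4e(t⁴ − 17)) + d₁s + d₂s² + d₃s³ + d₄s⁴`, `s = r − t` (exact in `t`). -/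
theorem taylor (t e r : K) :
    (1 - 4 * e) * r ^ 4 + 34 * r ^ 3 + 255 * r ^ 2 - 578 * r + (289 + 68 * e) =
      (w1 t ^ 2 - 4 * e * (t ^ 4 - 17)) + d1 t e * (r - t) + d2 t e * (r - t) ^ 2 + d3 t e * (r - t) ^ 3 +
        d4 e * (r - t) ^ 4 := by
  simp only [w1, d1, d2, d3, d4]; ring

/-- `u₀² − D(r) = 4Q(r)·P(x, r)` (completing the square in `x`). -/
theorem u0_sq (e x r : K) :
    u0 x r ^ 2 - ((1 - 4 * e) * r ^ 4 + 34 * r ^ 3 + 255 * r ^ 2 - 578 * r + (289 + 68 * e)) =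
      4 * (r ^ 4 - 17) * pS e x r := by
  simp only [u0, pS]; ring

/-- the FREE identity `Q̃² + s³(L₁ + L₀s) = 64w₁⁶(w₁² + d₁s + d₂s² + d₃s³ + d₄s⁴)`. -/
theorem Qt_sq (t e s : K) :
    Qt t e s ^ 2 + s ^ 3 * (L1 t e + L0 t e * s) =
      64 * w1 t ^ 6 * (w1 t ^ 2 + d1 t e * s + d2 t e * s ^ 2 + d3 t e * s ^ 3 + d4 e * s ^ 4) := by
  simp only [Qt, L1, L0, mm]; ring

/-- **THE KEY RELATION** `ζ² − 2Q̃ζ − s³(L₁ + L₀s) = 0` at a curve point (`t⁴ = 17`, `P(x, r) = 0`). -/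
theorem rel_eq_zero {t e x r : K} (ht : t ^ 4 = 17) (hP : pS e x r = 0) :
    zeta t e x r ^ 2 - 2 * Qt t e (r - t) * zeta t e x r - (r - t) ^ 3 * (L1 t e + L0 t e * (r - t)) = 0 := by
  have h1 := taylor t e r
  have h2 := u0_sq e x r
  have h3 := Qt_sq t e (r - t)
  rw [zeta]
  linear_combination (-1 : K) * h3 + 64 * w1 t ^ 6 * h2 + 64 * w1 t ^ 6 * h1 - 256 * w1 t ^ 6 * e * ht +
    256 * w1 t ^ 6 * (r ^ 4 - 17) * hP

/-- scaled Weierstrass equation: `(ζ/s², η/s³)` lies on `W` iff the `s⁶`-cleared identity holds. -/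
theorem equation_of_scaled (W : WeierstrassCurve K) {s z n : K} (hs : s ≠ 0)
    (h : n ^ 2 + W.a₁ * z * n * s + W.a₃ * n * s ^ 3 = z ^ 3 + W.a₂ * z ^ 2 * s ^ 2 + W.a₄ * z * s ^ 4 + W.a₆ * s ^ 6) :
    W.toAffine.Equation (z / s ^ 2) (n / s ^ 3) := by
  rw [WeierstrassCurve.Affine.equation_iff]
  have e1 : (n / s ^ 3) ^ 2 + W.a₁ * (z / s ^ 2) * (n / s ^ 3) + W.a₃ * (n / s ^ 3) =
      (n ^ 2 + W.a₁ * z * n * s + W.a₃ * n * s ^ 3) / s ^ 6 := by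
    field_simp
  have e2 : (z / s ^ 2) ^ 3 + W.a₂ * (z / s ^ 2) ^ 2 + W.a₄ * (z / s ^ 2) + W.a₆ =
      (z ^ 3 + W.a₂ * z ^ 2 * s ^ 2 + W.a₄ * z * s ^ 4 + W.a₆ * s ^ 6) / s ^ 6 := by
    field_simp
  simp only [WeierstrassCurve.toAffine] at e1 e2 ⊢
  rw [e1, e2, h]

/-- **`(X_E, Y_E)` LIES ON `W'`** at every curve point with `r ≠ t`. -/
theorem equation_XE_YE {t e x r : K} (ht : t ^ 4 = 17) (hP : pS e x r = 0) (hs : r - t ≠ 0) :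
    (cW t e).toAffine.Equation (XE t e x r) (YE t e x r) := by
  have hrel := rel_eq_zero ht hP
  rw [XE, YE]
  refine equation_of_scaled (cW t e) hs ?_
  simp only [cW_a₁, cW_a₂, cW_a₃, cW_a₄, cW_a₆]
  rw [Qt, L1, L0] at hrel
  linear_combination (-(zeta t e x r)) * hrel

/-- `c₄(W') = 256w₁⁴·Ĩ` with `Ĩ = 12d₄w₁² − 3d₃d₁ + d₂²` (FREE identity). -/
theorem cW_c₄ (t e : K) :
    (cW t e).c₄ = 256 * w1 t ^ 4 * (12 * d4 e * w1 t ^ 2 - 3 * d3 t e * d1 t e + d2 t e ^ 2) := by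
  simp only [WeierstrassCurve.c₄, WeierstrassCurve.b₂, WeierstrassCurve.b₄, cW_a₁, cW_a₂, cW_a₃, cW_a₄, mm]
  ring
/-- `c₆(W') = 2048w₁⁶·J̃` with `J̃ = 72d₄d₂w₁² + 9d₃d₂d₁ − 27d₄d₁² − 27w₁²d₃² − 2d₂³` (FREE identity). -/
theorem cW_c₆ (t e : K) :
    (cW t e).c₆ = 2048 * w1 t ^ 6 * (72 * d4 e * d2 t e * w1 t ^ 2 + 9 * d3 t e * d2 t e * d1 t e -
      27 * d4 e * d1 t e ^ 2 - 27 * w1 t ^ 2 * d3 t e ^ 2 - 2 * d2 t e ^ 3) := by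
  simp only [WeierstrassCurve.c₆, WeierstrassCurve.b₂, WeierstrassCurve.b₄, WeierstrassCurve.b₆, cW_a₁, cW_a₂, cW_a₃,
    cW_a₄, cW_a₆, mm]
  ring
/-- `Ĩ = I(D_e)` modulo `t⁴ = 17` (translation invariance of `I`). -/
theorem iTilde_eq {t : K} (ht : t ^ 4 = 17) (e : K) :
    12 * d4 e * w1 t ^ 2 - 3 * d3 t e * d1 t e + d2 t e ^ 2 = iK e := by
  simp only [d4, w1, d3, d1, d2, iK]
  linear_combination (48 * e - 192 * e ^ 2) * ht
/-- `J̃ = J(D_e)` modulo `t⁴ = 17`. -/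
theorem jTilde_eq {t : K} (ht : t ^ 4 = 17) (e : K) :
    72 * d4 e * d2 t e * w1 t ^ 2 + 9 * d3 t e * d2 t e * d1 t e - 27 * d4 e * d1 t e ^ 2 -
      27 * w1 t ^ 2 * d3 t e ^ 2 - 2 * d2 t e ^ 3 = jK e := by
  simp only [d4, w1, d3, d1, d2, jK]
  linear_combination (-51408 * e - 293760 * e ^ 2) * ht

/-- `w₁ ≠ 0`: `t² + 17t − 17 = 0` together with `t⁴ = 17` would force `t = 5185/5491`, whose fourth power is not `17`. -/
theorem w1_ne_zero [CharZero K] {t : K} (ht : t ^ 4 = 17) : w1 t ≠ 0 := by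
  intro h
  rw [w1, neg_eq_zero] at h
  have h1 : (5491 : K) * t = 5185 := by linear_combination (t ^ 2 - 17 * t + 306) * h - ht
  have h2 : t = 5185 / 5491 := by
    rw [eq_div_iff (by norm_num : (5491 : K) ≠ 0), mul_comm]; exact h1
  rw [h2] at ht
  norm_num at ht

/-- **`Δ(W') ≠ 0`** whenever `4I³ − J² ≠ 0` (`1728Δ = c₄³ − c₆² = 2²²w₁¹²(4I³ − J²)`). -/
theorem delta_ne_zero [CharZero K] {t : K} (ht : t ^ 4 = 17) {e : K} (hd : 4 * iK e ^ 3 - jK e ^ 2 ≠ 0) :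
    (cW t e).Δ ≠ 0 := by
  intro hΔ
  have hc := (cW t e).c_relation
  rw [hΔ, mul_zero, cW_c₄, cW_c₆, iTilde_eq ht, jTilde_eq ht] at hc
  have hw := w1_ne_zero ht
  have h : (2 : K) ^ 22 * w1 t ^ 12 * (4 * iK e ^ 3 - jK e ^ 2) = 0 := by linear_combination -hc
  simp only [mul_eq_zero, pow_eq_zero_iff, ne_eq, OfNat.ofNat_ne_zero, not_false_eq_true, hw, hd, or_self] at h

/-- `L₀ = 0 = L₁` is impossible on an elliptic `W'` (`a₃ = a₄ = a₆ = 0 ⇒ Δ = 0`). -/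
theorem L0_L1_ne [CharZero K] {t e : K} (hΔ : (cW t e).Δ ≠ 0) (hw : w1 t ≠ 0) : L0 t e ≠ 0 ∨ L1 t e ≠ 0 := by
  by_contra h
  simp only [not_or, not_not] at h
  obtain ⟨h0, h1⟩ := h
  have ha3 : (cW t e).a₃ = 0 := by
    have : 4 * w1 t ^ 2 * (cW t e).a₃ = L1 t e := by simp only [cW_a₃, L1]; ring
    rw [h1] at this
    simpa [hw] using this
  have ha4 : (cW t e).a₄ = 0 := by
    have : (cW t e).a₄ = -L0 t e := by simp only [cW_a₄, L0]; ring
    rw [this, h0, neg_zero]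
  apply hΔ
  simp only [WeierstrassCurve.Δ, WeierstrassCurve.b₂, WeierstrassCurve.b₄, WeierstrassCurve.b₆, WeierstrassCurve.b₈,
    ha3, ha4, cW_a₆]
  ring

/-- recovery of the ordinate: `r = t − L₁/L₀` at the point `(0, 0)` (`ζ = 0`), `r = t + 4w₁²X/Y` otherwise. -/
def recov (t w l0 l1 : K) (p : K × K) : K := if p.2 = 0 then t - l1 / l0 else t + 4 * w ^ 2 * p.1 / p.2

/-- **`recov (X_E, Y_E) = r`**. -/
theorem recov_XE_YE [CharZero K] {t e x r : K} (ht : t ^ 4 = 17) (hP : pS e x r = 0) (hs : r - t ≠ 0) (hw : w1 t ≠ 0)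
    (hL : L0 t e ≠ 0 ∨ L1 t e ≠ 0) :
    recov t (w1 t) (L0 t e) (L1 t e) (XE t e x r, YE t e x r) = r := by
  have hrel := rel_eq_zero ht hP
  by_cases hz : zeta t e x r = 0
  · have hY : YE t e x r = 0 := by rw [YE, hz, mul_zero, zero_div]
    rw [recov, if_pos hY]
    rw [hz] at hrel
    have h2 : L1 t e + L0 t e * (r - t) = 0 := by
      have : (r - t) ^ 3 * (L1 t e + L0 t e * (r - t)) = 0 := by linear_combination -hrel
      simpa [hs] using this
    have hL0 : L0 t e ≠ 0 := by
      rcases hL with h | h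
      · exact h
      · intro h0; apply h; rw [h0, zero_mul, add_zero] at h2; exact h2
    have h3 : r - t = -L1 t e / L0 t e := by
      rw [eq_div_iff hL0]
      linear_combination h2
    linear_combination -h3
  · have hY : YE t e x r ≠ 0 := by
      rw [YE]
      exact div_ne_zero (mul_ne_zero (mul_ne_zero (by norm_num) (pow_ne_zero 2 hw)) hz)
        (pow_ne_zero 3 hs)
    rw [recov, if_neg hY, XE, YE]
    field_simp
    ring

end Algebra

end Summit.Schanuel.Schanuel.Theorems.RootDecomp1KSiegelGenusOne

end
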